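import Literature.NumberTheory.Automorphic.WeaklyRegularGaloisRep
import Literature.NumberTheory.Automorphic.UnitaryCoherentGaloisRep
import HarnessLib

/-!
# Fakhruddin–Pilloni, Thm. 9.10, decomposed along its printed proof: descent to `U(n)` (Thm. 9.6)
# and Galois representations for representations that descend (Pilloni–Stroh / Goldring–Koskivirta)

Topic `NumberTheory/Automorphic`; decomposition file (librarian, fact-decompose `libsplit-37`,
human 2026-08-16) for the named fact `FakhruddinPilloni2021_galoisRep_of_weaklyRegular_odd` of
`WeaklyRegularGaloisRep.lean` — N. Fakhruddin, V. Pilloni, *Hecke operators and the coherent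
cohomology of Shimura varieties*, J. Inst. Math. Jussieu 22 (2023) = arXiv:1910.03790, Thm. 9.10
(CM field, `χ = 1`): Galois representations attached to weakly regular, algebraic, odd, conjugate
self dual, cuspidal `π` on `GL_n / K`.

Printed proof (p. 44 of the arXiv version, verbatim): "By the patching technique of [Sorensen], we
may reduce to the case of a `CM` field. Using Theorem 9.6, there is a `π̃` on the quasi-split
unitary group `U(n)/F`, which transfers to `π`. Moreover, `π̃_∞` is a non degenerate limit of
discrete series and therefore realizes in the coherent cohomology of a unitary Shimura variety. We
can then apply the main result of [Pilloni–Stroh 2016] or [Goldring–Koskivirta 2019] to conclude.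
The point is that the Hecke eigensystem of `π̃` is a `p`-adic limit of Hecke eigensystems of
regular, essentially conjugate self dual, automorphic representations to which Theorem 9.8
applies." — and Theorem 9.6 (p. 42): "Let `L` be a `CM`-field and `π` a weakly regular, algebraic,
odd, conjugate self dual, cuspidal automorphic representation of `GL_n/L`. Then there exists a
cuspidal automorphic representation `π̃` of the quasi-split unitary group `U(n)/F` such that `π` is
the transfer of `π̃` for the standard base change embedding and `π̃_∞` is a non degenerate limit of
discrete series." (Proof: Mok's endoscopic classification [Mok 2015]; the archimedean parameter
computation on p. 43.)

The two sentences are the two CHILDREN of the decomposition, named facts (D-0014) over the tree's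
unitary-group vocabulary (`UnitaryGroupAutomorphicRep.lean`, `UnitaryGroupLimitOfDiscreteSeriesAt.lean`,
as used by the accepted `GoldringKoskivirta2019_galoisRep_unitary`), the quasi-split group being
Mok's `U_{K/K⁺}(n)` for the maximal real subfield `K⁺ = NumberField.maximalRealSubfield K` and the
complex conjugation `NumberField.IsCMField.complexConj K : K ≃ₐ[K⁺] K` (the same `c` the parent
fact uses in its oddness hypothesis `HasAsaiSign π c 1`):

* `FakhruddinPilloni2021_thm_9_6` — **descent**: under the hypotheses of the parent fact there is
  a CUSPIDAL automorphic representation datum `σ` of `U_{K/K⁺}(n)` whose component at every real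
  place of `K⁺` (every complex place `w` of `K`, all fixed by `c`) is a non-degenerate limit of
  discrete series (`UnitaryGroup.IsNondegenerateLimitOfDiscreteSeriesAt`), and of which `π` is a
  weak base change for the standard embedding `ξ₁` (`UnitaryGroup.IsWeakBaseChange`: Satake
  parameters agree at all but finitely many finite places — the a.e. form of "transfers to `π`",
  weaker than print);
* `FakhruddinPilloni2021_galoisRep_of_unitaryDescent` — **Galois representations for cuspidal
  `π` on `GL_n/K` that so descend**: the conclusion of Thm. 9.10 (tree rendering: clause (2) at the
  unramified places, polarisation clause omitted, exactly as in the parent fact) for every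
  cuspidal `π` which is a weak base change of some cuspidal `σ` on `U_{K/K⁺}(n)` with
  non-degenerate limits of discrete series at infinity — the last three sentences of the printed
  proof (coherent cohomology, `p`-adic limits of regular eigensystems, Thm. 9.8), i.e.
  Pilloni–Stroh 2016 / Goldring–Koskivirta 2019, Thm. 3.5.5 (tree: `GoldringKoskivirta2019_galoisRep_unitary`,
  the unitary-group-side statement at `ℓ ∉ Ram`) carried back to `GL_n` by F–P.

* `FakhruddinPilloni2021_galoisRep_of_weaklyRegular_odd_holds_of : 9.6 → (9.10 | descent) → parent`
  — PROVED (three lines).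

Related tree facts: `Mok2014_standardBaseChange_descent` (`MokWeakBaseChange.lean`: descent of a
conjugate self-dual cuspidal `Π` with Asai sign `+1` to SOME automorphic `π` of `U_{E/F}(N)`, weak
base change) is the part of Thm. 9.6 without cuspidality of `π̃` and without the archimedean
statement; Thm. 9.6 adds both ("any representation `π̃ = ⊗ π̃_v` with `π̃_v ∈ Π_v` is cuspidal
automorphic", and the parameter computation at `v ∣ ∞` from weak regularity, p. 43).

## References

* [FakhruddinPilloni2021] N. Fakhruddin, V. Pilloni, J. Inst. Math. Jussieu 22 (2023) 1–69 =
  arXiv:1910.03790, §9.1 (notions), Thm. 9.6 and its proof (pp. 42–43), Thm. 9.10 and its proof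
  (p. 44) (text read).
* [GoldringKoskivirta2019] W. Goldring, J.-S. Koskivirta, Invent. Math. 217 (2019), Thm. 3.5.5.
* [Mok2014] C. P. Mok, Mem. AMS 235 (2015), Thm. 2.4.2, Thm. 2.5.2, Cor. 4.3.8.
* V. Pilloni, B. Stroh, *Surconvergence, ramification et modularité*, Astérisque 382 (2016).
-/

noncomputable section

open scoped NumberField Classical
open NumberField IsDedekindDomain

namespace Literature.NumberTheory.Automorphic

/-- **Fakhruddin–Pilloni, Thm. 9.6 — descent of weakly regular odd conjugate self-dual cuspidal
`π` to the quasi-split unitary group (named fact).** Printed (arXiv p. 42): "Let `L` be a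
`CM`-field and `π` a weakly regular, algebraic, odd, conjugate self dual, cuspidal automorphic
representation of `GL_n/L`. Then there exists a cuspidal automorphic representation `π̃` of the
quasi-split unitary group `U(n)/F` such that `π` is the transfer of `π̃` for the standard base
change embedding and `π̃_∞` is a non degenerate limit of discrete series." Rendering (hypotheses
exactly those of `FakhruddinPilloni2021_galoisRep_of_weaklyRegular_odd`): `K` CM with maximal real
subfield `K⁺` and complex conjugation `c = IsCMField.complexConj K`; `π` a cuspidal automorphic
representation datum of `GL_n(𝔸_K)` with an infinity type `T` that is C-algebraic and weakly
regular, `π^c ≅ π^∨` (`IsEssConjSelfDual π 1`), odd (`HasAsaiSign π c 1`). Conclusion: a CUSPIDAL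
automorphic representation datum `σ` of Mok's quasi-split `U_{K/K⁺}(n)(𝔸_{K⁺})`
(`UnitaryGroup.CuspidalAutomorphicRepData`) such that (a) at every complex place `w` of `K` (all are
fixed by `c`; they are the real places of `K⁺`) `σ` is a non-degenerate limit of discrete series
`π(λ, Ψ)` of some `U(p, q)` (`UnitaryGroup.IsNondegenerateLimitOfDiscreteSeriesAt`, for the
anti-diagonal form), and (b) `π` is a weak base change of `σ` for the standard embedding `ξ₁`
(`UnitaryGroup.IsWeakBaseChange`: at all but finitely many finite places of `K` the Satake
parameters of `π` are the base-change Satake parameters of `σ`) — the a.e. form of "transfers to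
`π`", weaker than the printed transfer at all places. Printed proof: Mok 2015 (local packets,
Thm. 2.5.2; "any representation `π̃ = ⊗_v π̃_v` with `π̃_v ∈ Π_v` is cuspidal automorphic") and the
archimedean computation of p. 43 (weak regularity ⟹ the parameter is a non-degenerate limit of
discrete series parameter). Users take `(h : FakhruddinPilloni2021_thm_9_6)`.
[cite: FakhruddinPilloni2021, Thm. 9.6 and its proof (arXiv pp. 42–43)] [cite: Mok2014, Thm. 2.4.2, Thm. 2.5.2] -/
def FakhruddinPilloni2021_thm_9_6 : Prop :=
  ∀ (n : ℕ) (K : Type) [Field K] [NumberField K] [IsCMField K]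
    (hcpt : isCompact_glFiniteIntegralLevel n K) (π : CuspidalAutomorphicRepData n K hcpt)
    (T : InfinityType K n), π.1.HasInfinityType T → T.IsCAlgebraic → T.IsWeaklyRegular →
      π.1.IsEssConjSelfDual 1 → π.1.HasAsaiSign (IsCMField.complexConj K) 1 →
        ∃ σ : UnitaryGroup.CuspidalAutomorphicRepData (maximalRealSubfield K) K
            (IsCMField.complexConj K) n hcpt,
          (∀ (w : {w : InfinitePlace K // w.IsComplex})
              (hw : IsCMField.complexConj K • w.1 = w.1),
            ∃ (p q : ℕ) (d : LDSDatum p q),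
              UnitaryGroup.IsNondegenerateLimitOfDiscreteSeriesAt (maximalRealSubfield K) K
                (IsCMField.complexConj K) n (StdForm.antidiagonal n) hcpt σ.1 hw
                (IsCMField.complexConj_ne_one K) d) ∧
          UnitaryGroup.IsWeakBaseChange (maximalRealSubfield K) K (IsCMField.complexConj K) n
            hcpt π.1 σ.1

/-- **Fakhruddin–Pilloni, Thm. 9.10 for representations that descend to `U(n)` — the
Pilloni–Stroh / Goldring–Koskivirta input in `GL_n`-form (named fact).** Printed proof of
Thm. 9.10 (arXiv p. 44), after the descent: "`π̃_∞` is a non degenerate limit of discrete series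
and therefore realizes in the coherent cohomology of a unitary Shimura variety. We can then apply
the main result of [Pilloni–Stroh] or [Goldring–Koskivirta] to conclude. The point is that the
Hecke eigensystem of `π̃` is a `p`-adic limit of Hecke eigensystems of regular, essentially
conjugate self dual, automorphic representations to which Theorem 9.8 applies." Rendering: for `K`
CM, `π` a cuspidal automorphic representation datum of `GL_n(𝔸_K)` and `σ` a cuspidal automorphic
representation datum of the quasi-split `U_{K/K⁺}(n)` with a non-degenerate limit of discrete
series at every real place of `K⁺` such that `π` is a weak base change of `σ` (standard embedding),
the conclusion of Thm. 9.10 in the tree's rendering holds: for every prime `ℓ` and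
`ι : ℚ̄_ℓ ≃+* ℂ` there is a continuous `r : Γ_K → GL_n(ℚ̄_ℓ)` (`FramedGaloisRep`) which, at every
finite `v ∤ ℓ` where `π` has Satake parameter `α`, is unramified with arithmetic-Frobenius
characteristic polynomial `arithFrobPolyOfSatake ι q_v n α` (printed:
`WD(ρ_{π,ι}|_{G_{L_v}})^{F-ss} = rec(π_v ⊗ |det|_v^{(1-n)/2})` at the unramified `v ∤ p`; the
polarisation clause is omitted, as in the parent fact). The unitary-group-side theorem is the
accepted `GoldringKoskivirta2019_galoisRep_unitary` (Goldring–Koskivirta, Thm. 3.5.5, at primes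
outside `Ram(G) ∪ Ram(σ)`); the passage to all `ℓ` and to all unramified places of `π` is the
printed claim of Thm. 9.10. Users take `(h : FakhruddinPilloni2021_galoisRep_of_unitaryDescent)`.
[cite: FakhruddinPilloni2021, Thm. 9.10 and its proof (arXiv p. 44)]
[cite: GoldringKoskivirta2019, Thm. 3.5.5] -/
def FakhruddinPilloni2021_galoisRep_of_unitaryDescent : Prop :=
  ∀ (n : ℕ) (K : Type) [Field K] [NumberField K] [IsCMField K]
    (hcpt : isCompact_glFiniteIntegralLevel n K) (π : CuspidalAutomorphicRepData n K hcpt)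
    (σ : UnitaryGroup.CuspidalAutomorphicRepData (maximalRealSubfield K) K
      (IsCMField.complexConj K) n hcpt),
    (∀ (w : {w : InfinitePlace K // w.IsComplex}) (hw : IsCMField.complexConj K • w.1 = w.1),
      ∃ (p q : ℕ) (d : LDSDatum p q),
        UnitaryGroup.IsNondegenerateLimitOfDiscreteSeriesAt (maximalRealSubfield K) K
          (IsCMField.complexConj K) n (StdForm.antidiagonal n) hcpt σ.1 hw
          (IsCMField.complexConj_ne_one K) d) →
    UnitaryGroup.IsWeakBaseChange (maximalRealSubfield K) K (IsCMField.complexConj K) n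
      hcpt π.1 σ.1 →
      ∀ (ℓ : ℕ) [Fact ℓ.Prime] (ι : PadicAlgCl ℓ ≃+* ℂ),
        ∃ r : GaloisRepresentations.FramedGaloisRep K (PadicAlgCl ℓ) n,
          ∀ (v : HeightOneSpectrum (𝓞 K)) (α : Multiset ℂ), π.1.HasSatakeParamAt v α →
            ((ℓ : ℕ) : 𝓞 K) ∉ v.asIdeal →
              r.IsUnramifiedAt v ∧
                r.HasFrobCharpolyAt v (arithFrobPolyOfSatake ι v.residueCard n α)

/-- **Decomposition of `FakhruddinPilloni2021_galoisRep_of_weaklyRegular_odd`** (Thm. 9.10, CM,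
`χ = 1`) from its two children, along the printed proof: descend `π` to a cuspidal `σ` on
`U_{K/K⁺}(n)` with non-degenerate limits of discrete series at infinity (Thm. 9.6,
`FakhruddinPilloni2021_thm_9_6`), then attach the Galois representation to `π` through `σ`
(`FakhruddinPilloni2021_galoisRep_of_unitaryDescent`).
[cite: FakhruddinPilloni2021, Thm. 9.10 (proof, arXiv p. 44) and Thm. 9.6] -/
theorem FakhruddinPilloni2021_galoisRep_of_weaklyRegular_odd_holds_of
    (h96 : FakhruddinPilloni2021_thm_9_6)
    (hPS : FakhruddinPilloni2021_galoisRep_of_unitaryDescent) :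
    FakhruddinPilloni2021_galoisRep_of_weaklyRegular_odd := by
  intro n K _ _ _ hcpt π T hT hC hW hsd hodd ℓ _ ι
  obtain ⟨σ, hσ, hbc⟩ := h96 n K hcpt π T hT hC hW hsd hodd
  exact hPS n K hcpt π σ hσ hbc ℓ ι

end Literature.NumberTheory.Automorphic

end
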